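import Mathlib
import Mathlib.MeasureTheory.Measure.Haar.Unique
import Mathlib.MeasureTheory.Integral.IntervalIntegral.Periodic
import Mathlib.Analysis.Fourier.AddCircle
import Mathlib.Analysis.SpecialFunctions.Complex.Circle
import Mathlib.MeasureTheory.Measure.Lebesgue.VolumeOfBalls
import Literature.MathematicalPhysics.QuantumFieldTheory.UnitaryColumnFibration
import Literature.MathematicalPhysics.QuantumFieldTheory.UnitaryCayleyChart
import Literature.Probability.RandomMatrix.HaarUnitaryGramSchmidt
import Literature.Probability.RandomMatrix.SphereCoordinateDensity
import HarnessLib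

/-!
# Haar measure of `U(N+1)` in the column-fibration coordinates

Second step (after `UnitaryColumnFibration`) of the proof, by induction on `N` and without Weyl's
integration formula, of the value of the Haar small-ball constant of `U(N)`
(S. Chatterjee, *The leading term of the Yang–Mills free energy*, J. Funct. Anal. 271 (2016),
arXiv:1602.01222, Thm. 6.1; in the tree the constant is `UnitaryCayley.haarChartConst`, file
`UnitaryCayleyChart`, and the value is established in `UnitaryHaarVolume`). Everything here is
proved; no definition of `Prop` type (named fact) is introduced.

Write `U ∈ U(N+1)` in the coordinates of `UnitaryColumnFibration`: `Ũ = R(w) · diag(W, u)` with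
`u = e^{iθ}` the phase of `U₀₀`, `w ∈ ℂ^N` (`|w|² = 1 - |U₀₀|²`) and `W ∈ U(N)`. The main result
`haar_image_mk_box` computes the Haar probability of coordinate boxes:

  `σ_{N+1} { R(w) diag(W, e^{it}) : |t| ≤ δ, |w| < ε, W ∈ C } = (δ/π) · ε^{2N} · σ_N(C)`

(`δ ≤ π`, `0 < ε ≤ 1`, `C ⊆ U(N)` measurable), i.e. in these coordinates the Haar probability
measure of `U(N+1)` is the product of `dt/2π`, of `N!/π^N dvol_{ℂ^N}(w)` on the unit ball, and
of the Haar probability measure of `U(N)`. Ingredients: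

* `eq_prod_haar_of_map_mul_left` (and its additive version) — **invariant measures on `X × G`
  are products**: a finite measure on `X × G`, `G` compact second countable, invariant under the
  left action of `G` on the second factor, is `(first marginal) ⊗ Haar` (uniqueness of Haar
  measure, `Measure.haarMeasure_unique`, applied to `t ↦ μ(s × t)`).
* `map_col0_haar` — the first column of a Haar unitary is `g/|g|` for a standard complex Gaussian
  vector `g` (from `haarProbability_eq_map_gsUnitary` of `RandomMatrix/HaarUnitaryGramSchmidt`);
  `gaussianPi_tail_nrm_mem`, `sphereHeadConst_one` — hence its tail is uniform on the unit ball of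
  `ℂ^N` with density `N!/π^N` (`RandomMatrix/SphereCoordinateDensity` with `e = 1`, and the
  Gaussian moment `∫_ℂ |z|^{2N} e^{-|z|²} = π N!`); `haar_apply_entry_zero_eq_zero` — `U₀₀ ≠ 0` a.s.
* `T = ((θ, w), W̃)` with `W̃ = W⁻¹`, its measurability, and the equivariances `T_mul_fib`
  (`U ↦ U diag(g,1)` acts by `W̃ ↦ g* W̃`) and `T_mul_dph` (`U ↦ U diag(1, e^{iβ})` acts by
  `θ ↦ θ + β`, off the null set); right invariance of `σ_{N+1}` then gives the product structure
  `lawT_eq_prod`, `map_wc_θc_eq_prod`, and `haar_preimage_T_box`.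
* `map_wc_cball` (`σ{|w| < ε} = ε^{2N}`), the parametrisation `mk` with `T_mk`, `mk_arg_wc`,
  `image_mk_box` (coordinate boxes are `T`-preimages), `haarAddCircle_closedBall`, and finally
  `haar_image_mk_box`.

## References

* S. Chatterjee, *The leading term of the Yang–Mills free energy*, J. Funct. Anal. 271 (2016)
  2944–3005, arXiv:1602.01222, §6. [arXiv160201222]
* F. Mezzadri, *How to generate random matrices from the classical compact groups*, Notices AMS 54
  (2007) 592–604, §5 (columns of Haar unitaries). [Mezzadri2007]
* Standard: J. Faraut, *Analysis on Lie groups*, CUP 2008, §9 (integration on `U(n)` via the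
  fibration over spheres).
-/


noncomputable section

open MeasureTheory Measure Set Filter Topology
open scoped ENNReal

namespace Literature.MathematicalPhysics.QuantumFieldTheory

namespace UnitaryColumn

/-- **Invariant measures on `X × G` are products.** Let `G` be a compact second-countable group and
`μ` a finite measure on `X × G` invariant under left multiplication in the `G`-factor. Then
`μ = μ_X ⊗ Haar`, where `μ_X` is the first marginal and `Haar` the Haar measure of total mass one
(uniqueness of Haar measure applied to the measures `t ↦ μ (s ×ˢ t)`). [folklore] -/
@[to_additive eq_prod_addHaar_of_map_add_left
  /-- **Invariant measures on `X × G` are products** (additive version). [folklore] -/]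
theorem eq_prod_haar_of_map_mul_left {X G : Type*} [MeasurableSpace X] [Group G] [TopologicalSpace G]
    [IsTopologicalGroup G] [CompactSpace G] [SecondCountableTopology G] [MeasurableSpace G] [BorelSpace G]
    (μ : Measure (X × G)) [IsFiniteMeasure μ]
    (h : ∀ g : G, μ.map (fun p : X × G => (p.1, g * p.2)) = μ) :
    μ = (μ.map Prod.fst).prod (haarMeasure ⊤) := by
  haveI : IsFiniteMeasure (haarMeasure (⊤ : TopologicalSpace.PositiveCompacts G)) := by
    refine ⟨?_⟩
    rw [← TopologicalSpace.PositiveCompacts.coe_top, haarMeasure_self]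
    exact ENNReal.one_lt_top
  symm
  refine Measure.prod_eq fun s t hs ht => ?_
  set ν : Measure G := (μ.restrict (s ×ˢ univ)).map Prod.snd with hν
  have hνt : ∀ t : Set G, MeasurableSet t → ν t = μ (s ×ˢ t) := by
    intro t ht
    rw [hν, Measure.map_apply measurable_snd ht, Measure.restrict_apply (measurable_snd ht)]
    congr 1
    ext ⟨x, g⟩
    simp only [mem_inter_iff, mem_preimage, mem_prod, mem_univ, and_true]
    tauto
  haveI : IsFiniteMeasure ν := by
    refine ⟨?_⟩
    rw [hνt _ MeasurableSet.univ]
    exact measure_lt_top _ _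
  haveI : ν.IsMulLeftInvariant := by
    refine ⟨fun g => ?_⟩
    have hL : Measurable fun p : X × G => (p.1, g * p.2) :=
      measurable_fst.prodMk (measurable_snd.const_mul g)
    have hpre : (fun p : X × G => (p.1, g * p.2)) ⁻¹' (s ×ˢ (univ : Set G)) = s ×ˢ univ := by
      ext ⟨x, k⟩; simp
    calc ν.map (g * ·) = (μ.restrict (s ×ˢ univ)).map (Prod.snd ∘ fun p : X × G => (p.1, g * p.2)) := by
          rw [hν, Measure.map_map (measurable_const_mul g) measurable_snd]; rfl
      _ = ((μ.restrict (s ×ˢ univ)).map (fun p : X × G => (p.1, g * p.2))).map Prod.snd := by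
          rw [Measure.map_map measurable_snd hL]
      _ = ((μ.map (fun p : X × G => (p.1, g * p.2))).restrict (s ×ˢ univ)).map Prod.snd := by
          rw [Measure.restrict_map hL (hs.prod MeasurableSet.univ), hpre]
      _ = ν := by rw [h g, hν]
  have huniq := haarMeasure_unique ν (⊤ : TopologicalSpace.PositiveCompacts G)
  have hfst : μ.map Prod.fst s = ν univ := by
    rw [Measure.map_apply measurable_fst hs, hνt _ MeasurableSet.univ]
    congr 1
    ext ⟨x, g⟩; simp
  rw [hfst, ← hνt t ht]
  conv_lhs => rw [huniq]
  rw [Measure.smul_apply, smul_eq_mul, TopologicalSpace.PositiveCompacts.coe_top]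

end UnitaryColumn

end Literature.MathematicalPhysics.QuantumFieldTheory


noncomputable section

open MeasureTheory Measure Set Filter Topology Complex WithLp
open scoped ENNReal NNReal Real
open Literature.Probability.RandomMatrix (gaussianPi gaussianEuc gsUnitary gsMatrix nsq sphereHead sphereHeadConst
  headProfile momentConst)
open Literature.Computability.QuantumComplexity (stdComplexGaussian stdComplexGaussianDensity
  stdComplexGaussian_eq_withDensity continuous_stdComplexGaussianDensity)

namespace Literature.MathematicalPhysics.QuantumFieldTheory

namespace UnitaryColumn

open UnitaryCayley (𝔾)

variable {N : ℕ}

/-! ### The first column of a Haar unitary is a normalised Gaussian vector -/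

/-- The first column of a unitary matrix. [folklore] -/
def col0 (U : 𝔾 (N + 1)) : Fin (N + 1) → ℂ := fun i => (U : Matrix (Fin (N + 1)) (Fin (N + 1)) ℂ) i 0

/-- `col0` is continuous. [folklore] -/
theorem continuous_col0 : Continuous (col0 (N := N)) :=
  continuous_pi fun i => (continuous_apply_apply i 0).comp continuous_subtype_val

/-- `col0` is measurable. [folklore] -/
theorem measurable_col0 : Measurable (col0 (N := N)) := continuous_col0.measurable

/-- Normalisation `g ↦ g / |g|` of a vector of `ℂ^{N+1}` (value `0` at `0`). [folklore] -/
def nrm (g : Fin (N + 1) → ℂ) : Fin (N + 1) → ℂ := (Real.sqrt (nsq g))⁻¹ • g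

/-- `nrm` is measurable. [folklore] -/
theorem measurable_nrm : Measurable (nrm (N := N)) := by
  unfold nrm
  exact (Literature.Probability.RandomMatrix.measurable_nsq.sqrt.inv).smul measurable_id

/-- Coordinates of `nrm g`. [folklore] -/
theorem nrm_apply (g : Fin (N + 1) → ℂ) (i : Fin (N + 1)) : nrm g i = (Real.sqrt (nsq g))⁻¹ • g i := rfl

/-- On linearly independent `g`, the first column of the Gram–Schmidt unitary is `g₀/|g₀|`. [folklore] -/
theorem col0_gsUnitary {g : Fin (N + 1) → EuclideanSpace ℂ (Fin (N + 1))} (hg : LinearIndependent ℂ g) :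
    col0 (gsUnitary g) = nrm (ofLp (g 0)) := by
  funext i
  rw [col0, Literature.Probability.RandomMatrix.coe_gsUnitary_of_linearIndependent hg]
  change (InnerProductSpace.gramSchmidtNormed ℂ g 0) i = _
  rw [InnerProductSpace.gramSchmidtNormed, show (0 : Fin (N + 1)) = ⊥ from rfl,
    InnerProductSpace.gramSchmidt_bot]
  rw [nrm_apply, Literature.Probability.RandomMatrix.sqrt_nsq_ofLp]
  change ((‖g ⊥‖ : ℂ)⁻¹ • g ⊥) i = _
  rw [PiLp.smul_apply, smul_eq_mul, Complex.real_smul, Complex.ofReal_inv]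

/-- **The first column of a Haar unitary is distributed as `g/|g|` for a standard complex Gaussian
vector `g`** (QR recipe: `haarProbability_eq_map_gsUnitary`). [cite: Mezzadri2007, §5] -/
theorem map_col0_haar :
    (haarProbability (𝔾 (N + 1))).map col0 = (gaussianPi (Fin (N + 1))).map nrm := by
  rw [Literature.Probability.RandomMatrix.haarProbability_eq_map_gsUnitary (N + 1),
    Measure.map_map measurable_col0 Literature.Probability.RandomMatrix.measurable_gsUnitary]
  set Γ : Measure (Fin (N + 1) → EuclideanSpace ℂ (Fin (N + 1))) :=
    Measure.pi fun _ => gaussianEuc (Fin (N + 1)) with hΓ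
  have hae : (col0 ∘ gsUnitary : (Fin (N + 1) → EuclideanSpace ℂ (Fin (N + 1))) → Fin (N + 1) → ℂ) =ᵐ[Γ]
      (nrm ∘ ofLp ∘ fun g => g 0) := by
    have h0 := Literature.Probability.RandomMatrix.pi_gaussianEuc_not_linearIndependent (m := N + 1)
      (N + 1) le_rfl
    rw [Filter.EventuallyEq, ae_iff]
    refine measure_mono_null (fun g hg => ?_) h0
    simp only [mem_setOf_eq]
    intro hli
    exact hg (by simp only [Function.comp_apply, col0_gsUnitary hli])
  rw [Measure.map_congr hae]
  have hm0 : Measurable fun g : Fin (N + 1) → EuclideanSpace ℂ (Fin (N + 1)) => g 0 := measurable_pi_apply 0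
  have hmo : Measurable (ofLp : EuclideanSpace ℂ (Fin (N + 1)) → Fin (N + 1) → ℂ) :=
    Literature.Probability.RandomMatrix.measurable_ofLp_two (Fin (N + 1))
  rw [show (nrm ∘ ofLp ∘ fun g : Fin (N + 1) → EuclideanSpace ℂ (Fin (N + 1)) => g 0) =
      (nrm ∘ ofLp) ∘ (fun g => g 0) from rfl,
    ← Measure.map_map (measurable_nrm.comp hmo) hm0, (measurePreserving_eval _ 0).map_eq,
    gaussianEuc, Measure.map_map (measurable_nrm.comp hmo)
      (Literature.Probability.RandomMatrix.measurable_toLp_two (Fin (N + 1)))]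
  rfl

/-! ### Splitting off the first coordinate of a Gaussian vector -/

/-- The tail `(g₁, …, g_N)` of a vector of `ℂ^{N+1}`. [folklore] -/
def tail (g : Fin (N + 1) → ℂ) : Fin N → ℂ := fun j => g j.succ

/-- Coordinates of the tail. [folklore] -/
@[simp] theorem tail_apply (g : Fin (N + 1) → ℂ) (j : Fin N) : tail g j = g j.succ := rfl

/-- `tail` is measurable. [folklore] -/
theorem measurable_tail : Measurable (tail (N := N)) :=
  measurable_pi_lambda _ fun _ => measurable_pi_apply _

/-- The splitting `g ↦ ((g₁,…,g_N), (g₀))` of `ℂ^{N+1}` into tail and head. [folklore] -/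
def split (g : Fin (N + 1) → ℂ) : (Fin N → ℂ) × (Fin 1 → ℂ) := (tail g, fun _ => g 0)

/-- `split` is measurable. [folklore] -/
theorem measurable_split : Measurable (split (N := N)) :=
  measurable_tail.prodMk (measurable_pi_lambda _ fun _ => measurable_pi_apply 0)

/-- **Independence of the coordinates**: `split` pushes `γ^{N+1}` to `γ^N ⊗ γ^1`. [folklore] -/
theorem measurePreserving_split :
    MeasurePreserving (split (N := N)) (gaussianPi (Fin (N + 1)))
      ((gaussianPi (Fin N)).prod (gaussianPi (Fin 1))) := by
  have h1 := measurePreserving_piFinSuccAbove (fun _ : Fin (N + 1) => stdComplexGaussian) 0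
  have h2 : MeasurePreserving (Prod.swap : ℂ × (Fin N → ℂ) → (Fin N → ℂ) × ℂ)
      ((stdComplexGaussian).prod (gaussianPi (Fin N))) ((gaussianPi (Fin N)).prod stdComplexGaussian) :=
    measurePreserving_swap
  have h3 : MeasurePreserving (Prod.map id (MeasurableEquiv.funUnique (Fin 1) ℂ).symm :
      (Fin N → ℂ) × ℂ → (Fin N → ℂ) × (Fin 1 → ℂ))
      ((gaussianPi (Fin N)).prod stdComplexGaussian) ((gaussianPi (Fin N)).prod (gaussianPi (Fin 1))) :=
    (MeasurePreserving.id _).prod ((measurePreserving_funUnique stdComplexGaussian (Fin 1)).symm _)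
  have h := (h3.comp h2).comp h1
  convert h using 1
  funext g
  refine Prod.ext ?_ ?_
  · funext j
    simp [split, MeasurableEquiv.piFinSuccAbove, Fin.insertNthEquiv, Fin.tail]
  · funext i
    obtain rfl : i = 0 := Subsingleton.elim _ _
    simp [split, MeasurableEquiv.piFinSuccAbove, Fin.insertNthEquiv, MeasurableEquiv.funUnique]
  · rfl

/-- `|g|² = |tail g|² + |g₀|²`. [folklore] -/
theorem nsq_eq_nsq_tail_add (g : Fin (N + 1) → ℂ) : nsq g = nsq (tail g) + nsq (fun _ : Fin 1 => g 0) := by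
  simp only [nsq, Fin.sum_univ_succ, tail_apply]
  ring

/-- The tail of the normalised vector is the `sphereHead` of the split vector. [folklore] -/
theorem tail_nrm (g : Fin (N + 1) → ℂ) : tail (nrm g) = sphereHead N 1 (split g) := by
  funext j
  simp only [tail_apply, nrm_apply, sphereHead, split, Pi.smul_apply, nsq_eq_nsq_tail_add g]

/-- **Law of the tail of a uniform unit vector**: for measurable `B` inside the open unit ball of
`ℂ^N` (`N ≥ 1`), `P(tail(g/|g|) ∈ B) = C_N · vol(B)` with `C_N = sphereHeadConst N 1`. [folklore] -/
theorem gaussianPi_tail_nrm_mem (hN : 1 ≤ N) {B : Set (Fin N → ℂ)} (hB : MeasurableSet B)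
    (hB1 : B ⊆ {w | nsq w < 1}) :
    gaussianPi (Fin (N + 1)) {g | tail (nrm g) ∈ B} = sphereHeadConst N 1 * volume B := by
  have hpre : {g : Fin (N + 1) → ℂ | tail (nrm g) ∈ B} = split ⁻¹' (sphereHead N 1 ⁻¹' B) := by
    ext g; simp [tail_nrm]
  have hmeas : MeasurableSet (sphereHead N 1 ⁻¹' B) :=
    Literature.Probability.RandomMatrix.measurable_sphereHead N 1 hB
  rw [hpre, measurePreserving_split.measure_preimage hmeas.nullMeasurableSet,
    ← Measure.map_apply (Literature.Probability.RandomMatrix.measurable_sphereHead N 1) hB,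
    Literature.Probability.RandomMatrix.map_sphereHead_gaussianPi_prod N 1 hN le_rfl,
    withDensity_apply _ hB]
  have hprof : ∀ w ∈ B, ENNReal.ofReal (headProfile N 1 w) = 1 := by
    intro w hw
    have h1 : nsq w < 1 := hB1 hw
    simp [headProfile, h1]
  rw [setLIntegral_congr_fun hB (fun w hw => by rw [hprof w hw, mul_one]), setLIntegral_const]

/-! ### The constant `sphereHeadConst N 1 = N!/π^N` -/

/-- `∫_{(0,∞)} t^N e^{-t} dt = N!` (as a lower Lebesgue integral). [folklore] -/
theorem lintegral_pow_mul_exp_neg (N : ℕ) :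
    ∫⁻ t in Ioi (0 : ℝ), ENNReal.ofReal (t ^ N) * ENNReal.ofReal (Real.exp (-t)) =
      ENNReal.ofReal (N.factorial) := by
  have hG := Real.Gamma_eq_integral (show (0 : ℝ) < N + 1 by positivity)
  rw [Real.Gamma_nat_eq_factorial] at hG
  have hint := Real.GammaIntegral_convergent (show (0 : ℝ) < N + 1 by positivity)
  simp only [add_sub_cancel_right, Real.rpow_natCast] at hG hint
  have hnn : 0 ≤ᵐ[volume.restrict (Ioi (0 : ℝ))] fun t => Real.exp (-t) * t ^ N :=
    (ae_restrict_iff' measurableSet_Ioi).2 (ae_of_all _ fun t ht =>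
      mul_nonneg (Real.exp_pos _).le (pow_nonneg (le_of_lt ht) _))
  rw [hG, ofReal_integral_eq_lintegral_ofReal hint hnn]
  refine setLIntegral_congr_fun measurableSet_Ioi fun t ht => ?_
  rw [← ENNReal.ofReal_mul (pow_nonneg (le_of_lt ht) _), mul_comm]

/-- The Gaussian moment `∫_ℂ |z|^{2N} e^{-|z|²} dz = π · N!`. [folklore] -/
theorem lintegral_normSq_pow_mul_exp (N : ℕ) :
    ∫⁻ z : ℂ, ENNReal.ofReal ((‖z‖ ^ 2) ^ N * Real.exp (-‖z‖ ^ 2)) =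
      ENNReal.ofReal π * ENNReal.ofReal (N.factorial) := by
  have hdens : Measurable fun z : ℂ => ENNReal.ofReal (stdComplexGaussianDensity z) :=
    ENNReal.measurable_ofReal.comp continuous_stdComplexGaussianDensity.measurable
  have hG : Measurable fun t : ℝ => ENNReal.ofReal (π * t ^ N) :=
    ENNReal.measurable_ofReal.comp (by fun_prop)
  have hGn : Measurable fun z : ℂ => ENNReal.ofReal (π * (‖z‖ ^ 2) ^ N) := hG.comp (by fun_prop)
  have h1 : ∀ z : ℂ, ENNReal.ofReal ((‖z‖ ^ 2) ^ N * Real.exp (-‖z‖ ^ 2)) =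
      ENNReal.ofReal (stdComplexGaussianDensity z) * ENNReal.ofReal (π * (‖z‖ ^ 2) ^ N) := by
    intro z
    rw [stdComplexGaussianDensity, ← ENNReal.ofReal_mul (by positivity)]
    congr 1
    field_simp
  simp_rw [h1]
  have h3 := lintegral_withDensity_eq_lintegral_mul volume hdens hGn
  simp only [Pi.mul_apply] at h3
  rw [← h3, ← stdComplexGaussian_eq_withDensity,
    Literature.Probability.RandomMatrix.lintegral_comp_normSq_stdComplexGaussian _ hG]
  have h2 : ∀ t : ℝ, t ∈ Ioi (0 : ℝ) → ENNReal.ofReal (π * t ^ N) * ENNReal.ofReal (Real.exp (-t)) =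
      ENNReal.ofReal π * (ENNReal.ofReal (t ^ N) * ENNReal.ofReal (Real.exp (-t))) := by
    intro t _
    rw [ENNReal.ofReal_mul Real.pi_pos.le, mul_assoc]
  rw [setLIntegral_congr_fun measurableSet_Ioi h2, lintegral_const_mul _ (by fun_prop),
    lintegral_pow_mul_exp_neg]

/-- `momentConst N 1 = π · N!`. [folklore] -/
theorem momentConst_one (N : ℕ) : momentConst N 1 = ENNReal.ofReal π * ENNReal.ofReal (N.factorial) := by
  rw [momentConst]
  have hmp := volume_preserving_funUnique (Fin 1) ℂ
  have hF : Measurable fun z : ℂ => ENNReal.ofReal ((‖z‖ ^ 2) ^ N * Real.exp (-‖z‖ ^ 2)) :=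
    ENNReal.measurable_ofReal.comp (by fun_prop)
  rw [← lintegral_normSq_pow_mul_exp N, ← hmp.lintegral_comp hF]
  refine lintegral_congr fun u => ?_
  have : nsq u = ‖u 0‖ ^ 2 := by simp [nsq]
  simp [MeasurableEquiv.funUnique, this]

/-- **The constant**: `sphereHeadConst N 1 = N!/π^N`, i.e. the tail of a uniform unit vector of
`ℂ^{N+1}` is uniformly distributed on the unit ball of `ℂ^N`. [folklore] -/
theorem sphereHeadConst_one (N : ℕ) :
    sphereHeadConst N 1 = ENNReal.ofReal ((N.factorial : ℝ) / π ^ N) := by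
  rw [sphereHeadConst, momentConst_one, ← ENNReal.ofReal_mul (by positivity),
    ← ENNReal.ofReal_mul (by positivity)]
  congr 1
  have hπ : (π : ℝ) ≠ 0 := Real.pi_pos.ne'
  field_simp
  ring

/-! ### The first coordinate vanishes with probability zero -/

/-- `γ^{N+1}{g₀ = 0} = 0`. [folklore] -/
theorem gaussianPi_apply_eval_zero_eq_zero :
    gaussianPi (Fin (N + 1)) {g | g 0 = 0} = 0 := by
  have h := (measurePreserving_eval (fun _ : Fin (N + 1) => stdComplexGaussian) 0).measure_preimage
    (measurableSet_singleton (0 : ℂ)).nullMeasurableSet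
  change Measure.pi (fun _ : Fin (N + 1) => stdComplexGaussian) {g | g 0 = 0} = 0
  have hset : {g : Fin (N + 1) → ℂ | g 0 = 0} = (fun g => g 0) ⁻¹' {0} := rfl
  rw [hset]
  refine h.trans ?_
  rw [stdComplexGaussian_eq_withDensity, withDensity_apply _ (measurableSet_singleton 0),
    Measure.restrict_singleton, measure_singleton, zero_smul, lintegral_zero_measure]

/-- `nrm g` has vanishing first coordinate iff `g` has. [folklore] -/
theorem nrm_apply_zero_eq_zero_iff (g : Fin (N + 1) → ℂ) : nrm g 0 = 0 ↔ g 0 = 0 := by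
  rw [nrm_apply, smul_eq_zero]
  constructor
  · rintro (h | h)
    · rw [inv_eq_zero, Real.sqrt_eq_zero (Literature.Probability.RandomMatrix.nsq_nonneg g),
        Literature.Probability.RandomMatrix.nsq_eq_zero_iff] at h
      rw [h]; rfl
    · exact h
  · intro h; exact Or.inr h

end UnitaryColumn

end Literature.MathematicalPhysics.QuantumFieldTheory

noncomputable section

open MeasureTheory Measure Set Filter Topology Complex
open scoped ENNReal NNReal Real

namespace Literature.MathematicalPhysics.QuantumFieldTheory

namespace UnitaryColumn

open UnitaryCayley (𝔾)
open Literature.Probability.RandomMatrix (nsq nsq_nonneg nsq_eq_zero_iff gaussianPi sphereHeadConst)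

variable {N : ℕ}

/-- `0 < 2π` as a `Fact`, for the `AddCircle (2π)` API (local instance only). [folklore] -/
theorem fact_two_pi_pos : Fact (0 < 2 * π) := ⟨Real.two_pi_pos⟩

attribute [local instance] fact_two_pi_pos

/-! ### The fibration coordinates of a Haar unitary -/

/-- The block form `Ũ` (indexed by `Fin N ⊕ Fin 1`, distinguished index `0`) of `U ∈ U(N+1)`. [folklore] -/
def blk (U : 𝔾 (N + 1)) : Matrix (Idx N) (Idx N) ℂ := ofFin (U : Matrix (Fin (N + 1)) (Fin (N + 1)) ℂ)

/-- `Ũ` is unitary. [folklore] -/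
theorem blk_mem (U : 𝔾 (N + 1)) : blk U ∈ Matrix.unitaryGroup (Idx N) ℂ := ofFin_mem_unitaryGroup U.2

/-- `blk` is multiplicative. [folklore] -/
theorem blk_mul (U V : 𝔾 (N + 1)) : blk (U * V) = blk U * blk V := ofFin_mul _ _

/-- Entries of `Ũ`. [folklore] -/
theorem blk_apply (U : 𝔾 (N + 1)) (i k : Idx N) :
    blk U i k = (U : Matrix (Fin (N + 1)) (Fin (N + 1)) ℂ) (eIdx N i) (eIdx N k) := rfl

/-- The distinguished entry of `Ũ` is `U₀₀`. [folklore] -/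
theorem blk_inr_inr (U : 𝔾 (N + 1)) :
    blk U (Sum.inr 0) (Sum.inr 0) = (U : Matrix (Fin (N + 1)) (Fin (N + 1)) ℂ) 0 0 := by
  rw [blk_apply, eIdx_inr]

/-- Entries of `Ũ` depend continuously on `U`. [folklore] -/
theorem continuous_blk_apply (i k : Idx N) : Continuous fun U : 𝔾 (N + 1) => blk U i k :=
  (continuous_apply_apply (eIdx N i) (eIdx N k)).comp continuous_subtype_val

/-- The fibre group `U(N) ↪ U(N+1)`, `g ↦ diag(g, 1)` (in `Fin (N+1)` indexing). [folklore] -/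
def fib (g : 𝔾 N) : 𝔾 (N + 1) :=
  ⟨toFin (bd (g : Matrix (Fin N) (Fin N) ℂ) 1), toFin_mem_unitaryGroup (bd_mem_unitaryGroup g.2 (by simp))⟩

/-- Block form of `fib g`. [folklore] -/
@[simp] theorem blk_fib (g : 𝔾 N) : blk (fib g) = bd (g : Matrix (Fin N) (Fin N) ℂ) 1 := ofFin_toFin _

/-- `|e^{iβ}| = 1`. [folklore] -/
theorem norm_exp_mul_I (β : ℝ) : ‖Complex.exp (β * I)‖ = 1 := by
  rw [Complex.norm_exp_ofReal_mul_I]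

/-- The phase rotation `D_β = diag(1, e^{iβ})` of the distinguished coordinate. [folklore] -/
def dph (β : ℝ) : 𝔾 (N + 1) :=
  ⟨toFin (bd (1 : Matrix (Fin N) (Fin N) ℂ) (Complex.exp (β * I))),
    toFin_mem_unitaryGroup (bd_mem_unitaryGroup (Submonoid.one_mem _) (norm_exp_mul_I β))⟩

/-- Block form of `dph β`. [folklore] -/
@[simp] theorem blk_dph (β : ℝ) : blk (dph β : 𝔾 (N + 1)) = bd (1 : Matrix (Fin N) (Fin N) ℂ) (Complex.exp (β * I)) :=
  ofFin_toFin _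

/-- The **phase coordinate** `θ(U) = arg u(Ũ) ∈ ℝ/2πℤ`. [folklore] -/
def θc (U : 𝔾 (N + 1)) : AddCircle (2 * π) := ((Complex.arg (uOf (blk U)) : ℝ) : AddCircle (2 * π))

/-- The **sphere coordinate** `w(U) ∈ ℂ^N` (rotated tail of the first column). [folklore] -/
def wc (U : 𝔾 (N + 1)) : Fin N → ℂ := wOf (blk U)

/-- The **fibre coordinate** `W̃(U) = W(Ũ)⁻¹ ∈ U(N)`. [folklore] -/
def Wt (U : 𝔾 (N + 1)) : 𝔾 N :=
  ⟨star (WOf (blk U)), Unitary.star_mem (eq_rot_mul_bd (blk_mem U)).2⟩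

/-- The coordinate map `T(U) = ((θ, w), W̃)`. [folklore] -/
def T (U : 𝔾 (N + 1)) : (AddCircle (2 * π) × (Fin N → ℂ)) × 𝔾 N := ((θc U, wc U), Wt U)

/-! ### Measurability of the coordinates -/

/-- A map into `U(N)` is Borel measurable as soon as its matrix entries are measurable. [folklore] -/
theorem measurable_to_𝔾 {α : Type*} [MeasurableSpace α] {f : α → 𝔾 N}
    (hf : Measurable fun a => fun j k => ((f a : 𝔾 N) : Matrix (Fin N) (Fin N) ℂ) j k) : Measurable f := by
  refine measurable_of_isOpen fun s hs => ?_
  obtain ⟨V, hV, rfl⟩ := isOpen_induced_iff.1 hs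
  have hV' : @IsOpen (Fin N → Fin N → ℂ) _ V := hV
  have hVm : @MeasurableSet (Fin N → Fin N → ℂ) _ V := hV'.measurableSet
  exact hf hVm

/-- `U ↦ u(Ũ)` is measurable. [folklore] -/
theorem measurable_uOf_blk : Measurable fun U : 𝔾 (N + 1) => uOf (blk U) :=
  measurable_phaseOf.comp (continuous_blk_apply _ _).measurable

/-- `θ` is measurable. [folklore] -/
theorem measurable_θc : Measurable (θc (N := N)) := by
  unfold θc
  exact (AddCircle.measurable_mk'.comp Complex.measurable_arg).comp measurable_uOf_blk

/-- `w` is measurable. [folklore] -/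
theorem measurable_wc : Measurable (wc (N := N)) := by
  refine measurable_pi_lambda _ fun j => ?_
  change Measurable fun U : 𝔾 (N + 1) => (starRingEnd ℂ) (uOf (blk U)) * blk U (Sum.inl j) (Sum.inr 0)
  exact (Complex.continuous_conj.measurable.comp measurable_uOf_blk).mul (continuous_blk_apply _ _).measurable

/-- Entries of `R(w(U))` are measurable in `U`. [folklore] -/
theorem measurable_rot_wc (i k : Idx N) : Measurable fun U : 𝔾 (N + 1) => rot (wc U) i k :=
  (continuous_rot_apply i k).measurable.comp measurable_wc

/-- `W̃` is measurable. [folklore] -/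
theorem measurable_Wt : Measurable (Wt (N := N)) := by
  refine measurable_to_𝔾 (measurable_pi_lambda _ fun j => measurable_pi_lambda _ fun k => ?_)
  change Measurable fun U : 𝔾 (N + 1) => (star (WOf (blk U))) j k
  simp only [Matrix.star_apply, WOf_apply, RCLike.star_def, _root_.map_sum, map_mul, Complex.conj_conj]
  refine Finset.measurable_sum _ fun l _ => ?_
  exact (measurable_rot_wc l _).mul
    (Complex.continuous_conj.measurable.comp (continuous_blk_apply _ _).measurable)

/-- `T` is measurable. [folklore] -/
theorem measurable_T : Measurable (T (N := N)) :=
  (measurable_θc.prodMk measurable_wc).prodMk measurable_Wt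

/-! ### Equivariance of the coordinates -/

/-- Right multiplication by the fibre group: `T(U · diag(g,1)) = ((θ, w), g* W̃)`. [folklore] -/
theorem T_mul_fib (U : 𝔾 (N + 1)) (g : 𝔾 N) :
    T (U * fib g) = ((θc U, wc U), star g * Wt U) := by
  have hblk : blk (U * fib g) = blk U * bd (g : Matrix (Fin N) (Fin N) ℂ) 1 := by rw [blk_mul, blk_fib]
  have hW : Wt (U * fib g) = star g * Wt U := by
    apply Subtype.ext
    change star (WOf (blk (U * fib g))) = star (g : Matrix (Fin N) (Fin N) ℂ) * star (WOf (blk U))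
    rw [hblk, WOf_mul_bd_one, star_mul]
  simp only [T, θc, wc, hblk, uOf_mul_bd_one, wOf_mul_bd_one, hW]

/-- `(arg (x e^{iβ}) : ℝ/2πℤ) = β + arg x` for `x ≠ 0`. [folklore] -/
theorem coe_arg_mul_exp (x : ℂ) (hx : x ≠ 0) (β : ℝ) :
    ((Complex.arg (x * Complex.exp (β * I)) : ℝ) : AddCircle (2 * π)) =
      (β : AddCircle (2 * π)) + ((Complex.arg x : ℝ) : AddCircle (2 * π)) := by
  have h : ((Complex.arg (x * Complex.exp (β * I)) : ℝ) : Real.Angle) =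
      (Complex.arg x : Real.Angle) + (Complex.arg (Complex.exp (β * I)) : Real.Angle) :=
    Complex.arg_mul_coe_angle hx (Complex.exp_ne_zero _)
  rw [Complex.arg_exp_mul_I, Real.Angle.coe_toIocMod, add_comm] at h
  exact h

/-- Right multiplication by the phase rotation, away from the null set `U₀₀ = 0`:
`T(U · D_β) = ((β + θ, w), W̃)`. [folklore] -/
theorem T_mul_dph {U : 𝔾 (N + 1)} (hU : (U : Matrix (Fin (N + 1)) (Fin (N + 1)) ℂ) 0 0 ≠ 0) (β : ℝ) :
    T (U * dph β) = (((β : AddCircle (2 * π)) + θc U, wc U), Wt U) := by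
  have hM0 : blk U (Sum.inr 0) (Sum.inr 0) ≠ 0 := by rwa [blk_inr_inr]
  have hblk : blk (U * dph β) = blk U * bd (1 : Matrix (Fin N) (Fin N) ℂ) (Complex.exp (β * I)) := by
    rw [blk_mul, blk_dph]
  have hz := norm_exp_mul_I β
  have hW : Wt (U * dph β) = Wt U := by
    apply Subtype.ext
    change star (WOf (blk (U * dph β))) = star (WOf (blk U))
    rw [hblk, WOf_mul_bd hM0 _ hz, Matrix.mul_one]
  simp only [T, θc, wc, hblk, uOf_mul_bd hM0 _ hz, wOf_mul_bd hM0 _ hz, hW]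
  rw [coe_arg_mul_exp (uOf (blk U)) (phaseOf_ne_zero _) β]

/-! ### The null set `U₀₀ = 0` -/

/-- `U₀₀` is the first coordinate of the first column. [folklore] -/
theorem col0_zero (U : 𝔾 (N + 1)) : col0 U 0 = (U : Matrix (Fin (N + 1)) (Fin (N + 1)) ℂ) 0 0 := rfl

/-- **`σ{U₀₀ = 0} = 0`** (the first column is a normalised Gaussian vector, whose first coordinate
vanishes with probability zero). [folklore] -/
theorem haar_apply_entry_zero_eq_zero :
    haarProbability (𝔾 (N + 1)) {U : 𝔾 (N + 1) | (U : Matrix (Fin (N + 1)) (Fin (N + 1)) ℂ) 0 0 = 0} = 0 := by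
  have hset : {U : 𝔾 (N + 1) | (U : Matrix (Fin (N + 1)) (Fin (N + 1)) ℂ) 0 0 = 0} = col0 ⁻¹' {v | v 0 = 0} := rfl
  have hm : MeasurableSet {v : Fin (N + 1) → ℂ | v 0 = 0} :=
    measurableSet_eq_fun (measurable_pi_apply 0) measurable_const
  rw [hset, ← Measure.map_apply measurable_col0 hm, map_col0_haar, Measure.map_apply measurable_nrm hm]
  have hset2 : nrm ⁻¹' {v : Fin (N + 1) → ℂ | v 0 = 0} = {g | g 0 = 0} := by
    ext g; simp [nrm_apply_zero_eq_zero_iff]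
  rw [hset2, gaussianPi_apply_eval_zero_eq_zero]

/-- The complement `U₀₀ ≠ 0` has full measure. [folklore] -/
theorem ae_entry_zero_ne_zero :
    ∀ᵐ U : 𝔾 (N + 1) ∂haarProbability (𝔾 (N + 1)), (↑U : Matrix (Fin (N + 1)) (Fin (N + 1)) ℂ) 0 0 ≠ 0 := by
  rw [ae_iff]
  simpa using haar_apply_entry_zero_eq_zero (N := N)

/-! ### The law of the coordinates is a product -/

/-- The law `μ = T_* σ` of the coordinates. [folklore] -/
def lawT (N : ℕ) : Measure ((AddCircle (2 * π) × (Fin N → ℂ)) × 𝔾 N) := (haarProbability (𝔾 (N + 1))).map T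

/-- `μ` is a probability measure. [folklore] -/
instance isProbabilityMeasure_lawT : IsProbabilityMeasure (lawT N) :=
  Measure.isProbabilityMeasure_map measurable_T.aemeasurable

/-- **Invariance of `μ` under the fibre group** (right invariance of Haar measure and
`T_mul_fib`). [folklore] -/
theorem lawT_map_mul_left (k : 𝔾 N) :
    (lawT N).map (fun p : (AddCircle (2 * π) × (Fin N → ℂ)) × 𝔾 N => (p.1, k * p.2)) = lawT N := by
  have hL : Measurable fun p : (AddCircle (2 * π) × (Fin N → ℂ)) × 𝔾 N => (p.1, k * p.2) :=
    measurable_fst.prodMk (measurable_snd.const_mul k)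
  have hR : Measurable fun U : 𝔾 (N + 1) => U * fib (star k) := measurable_id.mul_const _
  have hcomp : (fun p : (AddCircle (2 * π) × (Fin N → ℂ)) × 𝔾 N => (p.1, k * p.2)) ∘ T =
      T ∘ fun U : 𝔾 (N + 1) => U * fib (star k) := by
    funext U
    simp only [Function.comp_apply]
    rw [T_mul_fib, star_star]
    rfl
  rw [lawT, Measure.map_map hL measurable_T, hcomp, ← Measure.map_map measurable_T hR,
    map_mul_right_eq_self]

/-- **Invariance of the `(w, θ)`-law under phase shifts** (right invariance and `T_mul_dph`, valid
off the null set `U₀₀ = 0`). [folklore] -/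
theorem map_wc_θc_map_add_left (β : ℝ) :
    ((haarProbability (𝔾 (N + 1))).map (fun U => (wc U, θc U))).map
        (fun p : (Fin N → ℂ) × AddCircle (2 * π) => (p.1, (β : AddCircle (2 * π)) + p.2)) =
      (haarProbability (𝔾 (N + 1))).map (fun U => (wc U, θc U)) := by
  have hwθ : Measurable fun U : 𝔾 (N + 1) => (wc U, θc U) := measurable_wc.prodMk measurable_θc
  have hL : Measurable fun p : (Fin N → ℂ) × AddCircle (2 * π) => (p.1, (β : AddCircle (2 * π)) + p.2) :=
    measurable_fst.prodMk (measurable_snd.const_add _)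
  have hR : Measurable fun U : 𝔾 (N + 1) => U * dph β := measurable_id.mul_const _
  rw [Measure.map_map hL hwθ]
  have hae : ((fun p : (Fin N → ℂ) × AddCircle (2 * π) => (p.1, (β : AddCircle (2 * π)) + p.2)) ∘
      fun U : 𝔾 (N + 1) => (wc U, θc U)) =ᵐ[haarProbability (𝔾 (N + 1))]
      ((fun U : 𝔾 (N + 1) => (wc U, θc U)) ∘ fun U => U * dph β) := by
    filter_upwards [ae_entry_zero_ne_zero (N := N)] with U hU
    have h := T_mul_dph hU β
    simp only [T, Prod.mk.injEq] at h
    simp only [Function.comp_apply, Prod.mk.injEq]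
    exact ⟨h.1.2.symm, h.1.1.symm⟩
  rw [Measure.map_congr hae, ← Measure.map_map hwθ hR, map_mul_right_eq_self]

/-- `haarProbability` is the Haar measure normalised on the whole (compact) group. [folklore] -/
theorem haarProbability_eq_haarMeasure_top (G : Type*) [Group G] [TopologicalSpace G] [IsTopologicalGroup G]
    [CompactSpace G] [MeasurableSpace G] [BorelSpace G] :
    haarProbability G = haarMeasure ⊤ := rfl

/-- **Product structure, fibre direction**: `μ = μ₁₂ ⊗ σ_N`. [folklore] -/
theorem lawT_eq_prod : lawT N = ((lawT N).map Prod.fst).prod (haarProbability (𝔾 N)) := by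
  rw [haarProbability_eq_haarMeasure_top (𝔾 N)]
  exact eq_prod_haar_of_map_mul_left (lawT N) lawT_map_mul_left

/-- **Product structure, phase direction**: the law of `(w, θ)` is `Law(w) ⊗ Haar_{ℝ/2πℤ}`. [folklore] -/
theorem map_wc_θc_eq_prod :
    (haarProbability (𝔾 (N + 1))).map (fun U => (wc U, θc U)) =
      ((haarProbability (𝔾 (N + 1))).map wc).prod AddCircle.haarAddCircle := by
  have hwθ : Measurable fun U : 𝔾 (N + 1) => (wc U, θc U) := measurable_wc.prodMk measurable_θc
  haveI : IsProbabilityMeasure ((haarProbability (𝔾 (N + 1))).map (fun U => (wc U, θc U))) :=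
    Measure.isProbabilityMeasure_map hwθ.aemeasurable
  have h := eq_prod_addHaar_of_map_add_left ((haarProbability (𝔾 (N + 1))).map (fun U => (wc U, θc U)))
    (fun β => ?_)
  · rw [h, Measure.map_map measurable_fst hwθ]
    rfl
  · obtain ⟨b, rfl⟩ := QuotientAddGroup.mk_surjective β
    exact map_wc_θc_map_add_left b

/-- **The law of the coordinates on boxes**: for measurable `I ⊆ ℝ/2πℤ`, `B ⊆ ℂ^N`, `C ⊆ U(N)`,
`σ{θ ∈ I, w ∈ B, W̃ ∈ C} = Haar∠(I) · σ{w ∈ B} · σ_N(C)`. [folklore] -/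
theorem haar_preimage_T_box {I : Set (AddCircle (2 * π))} {B : Set (Fin N → ℂ)} {C : Set (𝔾 N)}
    (hI : MeasurableSet I) (hB : MeasurableSet B) (hC : MeasurableSet C) :
    haarProbability (𝔾 (N + 1)) (T ⁻¹' ((I ×ˢ B) ×ˢ C)) =
      AddCircle.haarAddCircle I * (haarProbability (𝔾 (N + 1))).map wc B * haarProbability (𝔾 N) C := by
  have hwθ : Measurable fun U : 𝔾 (N + 1) => (wc U, θc U) := measurable_wc.prodMk measurable_θc
  rw [← Measure.map_apply measurable_T ((hI.prod hB).prod hC), ← lawT, lawT_eq_prod,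
    Measure.prod_prod, Measure.map_apply measurable_fst (hI.prod hB)]
  congr 1
  -- the `(θ, w)` marginal
  have h1 : lawT N (Prod.fst ⁻¹' (I ×ˢ B)) = haarProbability (𝔾 (N + 1)) ((fun U => (wc U, θc U)) ⁻¹' (B ×ˢ I)) := by
    rw [lawT, Measure.map_apply measurable_T (measurable_fst (hI.prod hB))]
    congr 1
    ext U
    simp [T, and_comm]
  rw [h1, ← Measure.map_apply hwθ (hB.prod hI), map_wc_θc_eq_prod, Measure.prod_prod, mul_comm]

/-! ### The law of the sphere coordinate on circular sets -/

/-- `w(U) = ū · tail(col₀ U)`. [folklore] -/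
theorem wc_eq_smul_tail_col0 (U : 𝔾 (N + 1)) : wc U = (starRingEnd ℂ) (uOf (blk U)) • tail (col0 U) := by
  funext j
  simp only [wc, wOf, Pi.smul_apply, smul_eq_mul, tail_apply, col0, blk_apply, eIdx_inl, eIdx_inr]

/-- **Law of `w` on circular sets**: for a measurable `B ⊆ {|w| < 1}` invariant under unit scalars,
`σ{w ∈ B} = C_N vol(B)`, `C_N = N!/π^N` (`N ≥ 1`). [folklore] -/
theorem map_wc_apply_of_circular (hN : 1 ≤ N) {B : Set (Fin N → ℂ)} (hB : MeasurableSet B)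
    (hB1 : B ⊆ {w | nsq w < 1}) (hBc : ∀ c : ℂ, ‖c‖ = 1 → ∀ x : Fin N → ℂ, c • x ∈ B ↔ x ∈ B) :
    (haarProbability (𝔾 (N + 1))).map wc B = sphereHeadConst N 1 * volume B := by
  rw [Measure.map_apply measurable_wc hB]
  have hset : wc ⁻¹' B = col0 ⁻¹' (tail ⁻¹' B) := by
    ext U
    simp only [mem_preimage, wc_eq_smul_tail_col0]
    exact hBc _ (by rw [Complex.norm_conj, norm_uOf]) _
  rw [hset, ← Measure.map_apply measurable_col0 (measurable_tail hB), map_col0_haar,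
    Measure.map_apply measurable_nrm (measurable_tail hB)]
  exact gaussianPi_tail_nrm_mem hN hB hB1

/-- The ball `{|w| < ε}` of `ℂ^N`. [folklore] -/
def cball (N : ℕ) (ε : ℝ) : Set (Fin N → ℂ) := {w | nsq w < ε ^ 2}

/-- The ball is measurable. [folklore] -/
theorem measurableSet_cball (ε : ℝ) : MeasurableSet (cball N ε) :=
  measurableSet_lt Literature.Probability.RandomMatrix.measurable_nsq measurable_const

/-- The ball is invariant under unit scalars. [folklore] -/
theorem smul_mem_cball_iff {c : ℂ} (hc : ‖c‖ = 1) (ε : ℝ) (x : Fin N → ℂ) : c • x ∈ cball N ε ↔ x ∈ cball N ε := by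
  have h : nsq (c • x) = nsq x := by
    simp only [nsq, Pi.smul_apply, smul_eq_mul, norm_mul, hc, one_mul]
  simp [cball, h]

/-- `cball N ε ⊆ {|w| < 1}` for `ε ≤ 1`. [folklore] -/
theorem cball_subset {ε : ℝ} (hε : 0 < ε) (hε1 : ε ≤ 1) : cball N ε ⊆ {w | nsq w < 1} := fun w hw => by
  have h : ε ^ 2 ≤ 1 := by nlinarith
  exact lt_of_lt_of_le hw h

/-- **Volume of the ball of `ℂ^N`**: `vol{|w| < ε} = ε^{2N} π^N / N!`. [folklore] -/
theorem volume_cball (hN : 1 ≤ N) {ε : ℝ} (hε : 0 < ε) :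
    volume (cball N ε) = ENNReal.ofReal (ε ^ (2 * N)) * ENNReal.ofReal (π ^ N / N.factorial) := by
  haveI : Nonempty (Fin N) := ⟨⟨0, hN⟩⟩
  have h := Complex.volume_sum_rpow_lt (ι := Fin N) (p := 2) (by norm_num) ε
  have hset : {x : Fin N → ℂ | (∑ i, ‖x i‖ ^ (2 : ℝ)) ^ (1 / (2 : ℝ)) < ε} = cball N ε := by
    ext x
    simp only [mem_setOf_eq, cball, nsq, Real.rpow_two]
    rw [← Real.sqrt_eq_rpow, Real.sqrt_lt' hε]
  rw [hset] at h
  rw [h, Fintype.card_fin, ENNReal.ofReal_pow hε.le]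
  congr 2
  have h1 : Real.Gamma (2 / 2 + 1) = 1 := by norm_num [Real.Gamma_two]
  have h2 : Real.Gamma (2 * N / 2 + 1) = N.factorial := by
    rw [show (2 * N / 2 + 1 : ℝ) = N + 1 by ring, Real.Gamma_nat_eq_factorial]
  rw [h1, h2, mul_one]

/-- **Law of `w` on balls**: `σ{|w| < ε} = ε^{2N}` for `0 < ε ≤ 1`. [folklore] -/
theorem map_wc_cball {ε : ℝ} (hε : 0 < ε) (hε1 : ε ≤ 1) :
    (haarProbability (𝔾 (N + 1))).map wc (cball N ε) = ENNReal.ofReal (ε ^ (2 * N)) := by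
  rcases Nat.eq_zero_or_pos N with hN | hN
  · subst hN
    have huniv : cball 0 ε = univ := by
      ext w
      simp only [cball, mem_setOf_eq, mem_univ, iff_true, nsq, Finset.univ_eq_empty, Finset.sum_empty]
      positivity
    rw [huniv, Measure.map_apply measurable_wc MeasurableSet.univ, preimage_univ, measure_univ]
    simp
  · rw [map_wc_apply_of_circular hN (measurableSet_cball ε) (cball_subset hε hε1)
      (fun c hc x => smul_mem_cball_iff hc ε x), sphereHeadConst_one, volume_cball hN hε,
      ← ENNReal.ofReal_mul (by positivity), ← ENNReal.ofReal_mul (by positivity)]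
    congr 1
    have hπ : (π : ℝ) ^ N ≠ 0 := pow_ne_zero _ Real.pi_pos.ne'
    have hf : (N.factorial : ℝ) ≠ 0 := by positivity
    field_simp

/-! ### The section `mk` and the Haar measure of coordinate boxes -/

/-- The **parametrisation** `(t, w, W) ↦ R(w) · diag(W, e^{it}) ∈ U(N+1)` (junk value `1` when
`|w| > 1`). [folklore] -/
def mk (t : ℝ) (w : Fin N → ℂ) (W : 𝔾 N) : 𝔾 (N + 1) :=
  if h : nsq w ≤ 1 then
    ⟨toFin (rot w * bd (W : Matrix (Fin N) (Fin N) ℂ) (Complex.exp (t * I))),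
      toFin_mem_unitaryGroup (Submonoid.mul_mem _ (rot_mem_unitaryGroup h)
        (bd_mem_unitaryGroup W.2 (norm_exp_mul_I t)))⟩
  else 1

/-- Block form of `mk t w W`. [folklore] -/
theorem blk_mk {t : ℝ} {w : Fin N → ℂ} (hw : nsq w ≤ 1) (W : 𝔾 N) :
    blk (mk t w W) = rot w * bd (W : Matrix (Fin N) (Fin N) ℂ) (Complex.exp (t * I)) := by
  rw [mk, dif_pos hw, blk]
  exact ofFin_toFin _

/-- `(arg e^{it} : ℝ/2πℤ) = t`. [folklore] -/
theorem coe_arg_exp_mul_I (t : ℝ) :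
    ((Complex.arg (Complex.exp (t * I)) : ℝ) : AddCircle (2 * π)) = (t : AddCircle (2 * π)) := by
  rw [Complex.arg_exp_mul_I]
  exact Real.Angle.coe_toIocMod t _

/-- **Coordinates of the parametrisation**: `T(mk(t, w, W)) = ((t, w), W*)` for `|w| < 1`. [folklore] -/
theorem T_mk {t : ℝ} {w : Fin N → ℂ} (hw : nsq w < 1) (W : 𝔾 N) :
    T (mk t w W) = (((t : AddCircle (2 * π)), w), star W) := by
  have hb := blk_mk (t := t) hw.le W
  have hu := norm_exp_mul_I t
  have hW : Wt (mk t w W) = star W := by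
    apply Subtype.ext
    change star (WOf (blk (mk t w W))) = star (W : Matrix (Fin N) (Fin N) ℂ)
    rw [hb, WOf_rot_mul_bd hw _ hu]
  simp only [T, θc, wc, hb, uOf_rot_mul_bd hw _ hu, wOf_rot_mul_bd hw _ hu, hW, coe_arg_exp_mul_I]

/-- **The parametrisation inverts the coordinates**: `mk(arg u, w(U), W(U)) = U`. [folklore] -/
theorem mk_arg_wc (U : 𝔾 (N + 1)) : mk (Complex.arg (uOf (blk U))) (wc U) (star (Wt U)) = U := by
  have hw : nsq (wc U) ≤ 1 := nsq_wOf_le (blk_mem U)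
  have hexp : Complex.exp ((Complex.arg (uOf (blk U)) : ℝ) * I) = uOf (blk U) := by
    have h := Complex.norm_mul_exp_arg_mul_I (uOf (blk U))
    rwa [norm_uOf, Complex.ofReal_one, one_mul] at h
  apply Subtype.ext
  rw [mk, dif_pos hw]
  change toFin (rot (wc U) * bd (star (star (WOf (blk U)))) (Complex.exp ((Complex.arg (uOf (blk U)) : ℝ) * I))) = _
  rw [star_star, hexp, wc, ← (eq_rot_mul_bd (blk_mem U)).1, blk, toFin_ofFin]

/-- `‖(t : ℝ/2πℤ)‖ = |t|` for `|t| ≤ π`. [folklore] -/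
theorem norm_coe_addCircle {t : ℝ} (ht : |t| ≤ π) : ‖(t : AddCircle (2 * π))‖ = |t| := by
  rw [AddCircle.norm_coe_eq_abs_iff (2 * π) Real.two_pi_pos.ne']
  rwa [abs_of_pos Real.two_pi_pos, mul_div_cancel_left₀ _ (two_ne_zero' ℝ)]

/-- **Coordinate boxes are images of boxes**: for `0 < δ ≤ π` and `B ⊆ {|w| < 1}`,
`mk(Icc(-δ,δ) × B × C) = T⁻¹(B̄(0,δ) × B × star⁻¹ C)`. [folklore] -/
theorem image_mk_box {δ : ℝ} (hδπ : δ ≤ π) {B : Set (Fin N → ℂ)} (hB1 : B ⊆ {w | nsq w < 1})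
    (C : Set (𝔾 N)) :
    (fun p : ℝ × (Fin N → ℂ) × 𝔾 N => mk p.1 p.2.1 p.2.2) '' (Icc (-δ) δ ×ˢ (B ×ˢ C)) =
      T ⁻¹' ((Metric.closedBall (0 : AddCircle (2 * π)) δ ×ˢ B) ×ˢ (star ⁻¹' C)) := by
  ext U
  simp only [mem_image, mem_prod, mem_Icc, mem_preimage, Metric.mem_closedBall, dist_zero_right, Prod.exists]
  constructor
  · rintro ⟨t, w, W, ⟨⟨ht1, ht2⟩, hw, hW⟩, rfl⟩
    have hw1 : nsq w < 1 := hB1 hw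
    rw [T_mk hw1]
    refine ⟨⟨?_, hw⟩, by simpa using hW⟩
    have ht : |t| ≤ π := (abs_le.2 ⟨ht1, ht2⟩).trans hδπ
    rw [norm_coe_addCircle ht]
    exact abs_le.2 ⟨ht1, ht2⟩
  · rintro ⟨⟨hθ, hw⟩, hW⟩
    refine ⟨Complex.arg (uOf (blk U)), wc U, star (Wt U), ⟨?_, hw, hW⟩, mk_arg_wc U⟩
    have hπ : |Complex.arg (uOf (blk U))| ≤ π := abs_le.2 ⟨(Complex.neg_pi_lt_arg _).le, Complex.arg_le_pi _⟩
    have h : ‖θc U‖ ≤ δ := hθ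
    rw [θc, norm_coe_addCircle hπ] at h
    exact abs_le.1 h

/-- Haar measure of an arc of `ℝ/2πℤ`: `Haar∠(B̄(0, δ)) = δ/π` for `δ ≤ π` (both sides vanish for
`δ < 0`). [folklore] -/
theorem haarAddCircle_closedBall {δ : ℝ} (hδπ : δ ≤ π) :
    AddCircle.haarAddCircle (Metric.closedBall (0 : AddCircle (2 * π)) δ) = ENNReal.ofReal (δ / π) := by
  have h := congrArg (fun μ : Measure (AddCircle (2 * π)) => μ (Metric.closedBall (0 : AddCircle (2 * π)) δ))
    (AddCircle.volume_eq_smul_haarAddCircle (T := 2 * π))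
  simp only [Measure.smul_apply, smul_eq_mul, AddCircle.volume_closedBall,
    min_eq_right (by linarith : 2 * δ ≤ 2 * π)] at h
  have h2π : ENNReal.ofReal (2 * π) ≠ 0 := by simp [Real.pi_pos]
  rw [eq_comm, ← ENNReal.eq_div_iff h2π ENNReal.ofReal_ne_top] at h
  rw [h, ← ENNReal.ofReal_div_of_pos Real.two_pi_pos]
  congr 1
  field_simp

/-- Haar measure of `U(N)` is invariant under `W ↦ W*`. [folklore] -/
theorem haar_preimage_star (C : Set (𝔾 N)) : haarProbability (𝔾 N) (star ⁻¹' C) = haarProbability (𝔾 N) C := by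
  rw [Unitary.star_eq_inv']
  exact Measure.measure_preimage_inv _ _

/-- **Haar measure of coordinate boxes.** For `δ ≤ π`, `0 < ε ≤ 1` and measurable `C ⊆ U(N)`,
`σ_{N+1}{R(w) diag(W, e^{it}) : |t| ≤ δ, |w| < ε, W ∈ C} = (δ/π) · ε^{2N} · σ_N(C)`: in the
coordinates `(t, w, W)` the Haar probability measure of `U(N+1)` near `1` is the product of
`dt/2π`, of `N!/π^N · dvol_{ℂ^N}(w)` and of the Haar probability measure of `U(N)`. [folklore] -/
theorem haar_image_mk_box {δ ε : ℝ} (hδπ : δ ≤ π) (hε : 0 < ε) (hε1 : ε ≤ 1)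
    {C : Set (𝔾 N)} (hC : MeasurableSet C) :
    haarProbability (𝔾 (N + 1))
        ((fun p : ℝ × (Fin N → ℂ) × 𝔾 N => mk p.1 p.2.1 p.2.2) '' (Icc (-δ) δ ×ˢ (cball N ε ×ˢ C))) =
      ENNReal.ofReal (δ / π) * ENNReal.ofReal (ε ^ (2 * N)) * haarProbability (𝔾 N) C := by
  rw [image_mk_box hδπ (cball_subset hε hε1) C,
    haar_preimage_T_box Metric.isClosed_closedBall.measurableSet (measurableSet_cball ε)
      (continuous_star.measurable hC),
    haarAddCircle_closedBall hδπ, map_wc_cball hε hε1, haar_preimage_star]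

end UnitaryColumn

end Literature.MathematicalPhysics.QuantumFieldTheory
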